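import Literature.NumberTheory.LFunctions.PretentiousZeta
import Literature.NumberTheory.LFunctions.ZetaZeroFreeRegion
import Literature.NumberTheory.LFunctions.VinogradovKorobov
import Mathlib.Analysis.ODE.Gronwall
import HarnessLib

/-!
# Pretentious distances at heights `|t| ≤ x^A` from Ford's bound for `ζ(1 + it)` (Matomäki–Radziwiłł 2016, Lemma 2)

Topic `Literature/NumberTheory/LFunctions`.  Everything in this file is PROVED, conditionally on the single
named fact `zeta_bound_ford` (`VinogradovKorobov.lean`: Ford 2002, Thm 1,
`|ζ(σ + it)| ≤ 76.2 t^{4.45(1−σ)^{3/2}} (log t)^{2/3}`, used only at `σ = 1`).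

K. Matomäki, M. Radziwiłł, *Multiplicative functions in short intervals*, Ann. of Math. 183 (2016), §2,
Lemma 2: "Let `f : ℕ → [-1, 1]` be multiplicative and `ε > 0`. For any fixed `A` and `1 ≤ |α| ≤ x^A`,
`𝔻(f, p^{iα}; x) ≥ (1/(2√3) − ε) √(log log x) + O(1)`."  The printed proof is two lines: the triangle
inequality `2𝔻(f, p^{iα}) ≥ 𝔻(1, p^{2iα})`, and
`𝔻(1, p^{2iα}; x)² ≥ (1/3 − ε) log log x + O(1)` "by the zero-free region for the Riemann zeta-function"
— meaning the Vinogradov–Korobov region, through `|∑_{exp((log x)^{2/3+ε}) ≤ p ≤ x} p^{-1-2iα}| = O(1)`.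
Here the second step is replaced by the equivalent input on the one-line, Ford's Richert-type bound
`|ζ(1 + it)| ≪ (log t)^{2/3}`, which gives the statement with `ε = 0`:

* `PretentiousFord.exists_norm_zeta_right_le` — `|ζ(σ₂ + it)| ≤ |ζ(σ₁ + it)| e^{C log|t| (σ₂ − σ₁)}` for
  `1 ≤ σ₁ ≤ σ₂`, `|t| ≥ 2` (Grönwall along the horizontal segment, with `|ζ'/ζ| ≤ C log|t|` on `σ ≥ 1`
  from the classical zero-free region, `exists_norm_logDeriv_riemannZeta_le` = MV Thm 6.7);
* `PretentiousFord.pretentiousDistSq_one_twist_ge` — for `A > 0`: `𝔻(1, n^{it}; x)² ≥ (1/3) log log x − C_A`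
  for `x ≥ x₀`, `2 ≤ |t| ≤ x^A` (from `exists_pretentiousDistSq_one_zeta_approx`:
  `𝔻² = log log x − log|ζ(σ_x − it)| + O(1)`, `σ_x = 1 + 1/log x`, and the two bullets above;
  `|t| ≤ 3` by compactness);
* `PretentiousFord.matomakiRadziwill_lemma2_of_ford` — **Lemma 2**: `𝔻(f, n^{iα}; x)² ≥ (1/12) log log x − C_A`
  for real `|f| ≤ 1` (multiplicativity unused), `x ≥ x₀`, `1 ≤ |α| ≤ x^A`; the triangle-inequality step
  is done termwise (`pretentiousDistSq_one_double_le`: `1 − cos 2θ ≤ 4(1 − f cos θ)`).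

These are inputs of MR Lemma 3 (`Literature.NumberTheory.Sieve.MatomakiRadziwill2016_lemma3`, named) and of
Matomäki–Radziwiłł–Tao 2015, Lemma A.4 / (1.12).

## References
* K. Matomäki, M. Radziwiłł, Ann. of Math. (2) 183 (2016) (arXiv:1501.04585), §2 Lemma 2.
  [cite: MatomakiRadziwillAnnals2016, Lemma 2]
* K. Ford, *Vinogradov's integral and bounds for the Riemann zeta function*, Proc. LMS 85 (2002), Thm 1.
  [cite: Ford2002, Theorem 1]
* H. L. Montgomery, R. C. Vaughan, *Multiplicative Number Theory I*, CUP 2007, Thm 6.7 (via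
  `ZetaZeroFreeRegion.lean`).

## Design choices
* Distances are `Literature.NumberTheory.Sieve.pretentiousDistSq f (fun n ↦ (n : ℂ) ^ (t I)) x`
  (`PretentiousDistance.lean`), i.e. `∑_{p ≤ x} (1 − Re f(p) p^{-it})/p`, as in `MatomakiRadziwill.lean`.
* Statements are squared and with explicit `∃ x₀ C` instead of `O(1)`; constants are not optimised.
-/

noncomputable section

open Complex Real Set

namespace Literature.NumberTheory.LFunctions

namespace PretentiousFord

/-! ### From `σ = 1` to `σ > 1`: Grönwall with `ζ'/ζ ≪ log|t|` -/

/-- **Moving off the one-line**: there is an absolute `C ≥ 0` such that for `|t| ≥ 2` and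
`1 ≤ σ₁ ≤ σ₂`, `|ζ(σ₂ + it)| ≤ |ζ(σ₁ + it)| exp(C log|t| (σ₂ − σ₁))` — Grönwall's inequality for
`u ↦ ζ(u + it)` with `|ζ'(u+it)| ≤ C log|t| |ζ(u+it)|` (Montgomery–Vaughan Thm 6.7,
`exists_norm_logDeriv_riemannZeta_le`). [folklore] -/
theorem exists_norm_zeta_right_le :
    ∃ C : ℝ, 0 ≤ C ∧ ∀ σ₁ σ₂ t : ℝ, 2 ≤ |t| → 1 ≤ σ₁ → σ₁ ≤ σ₂ →
      ‖riemannZeta (σ₂ + t * I)‖ ≤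
        ‖riemannZeta (σ₁ + t * I)‖ * Real.exp (C * Real.log |t| * (σ₂ - σ₁)) := by
  obtain ⟨c, hc, C, hC, hld⟩ := exists_norm_logDeriv_riemannZeta_le
  refine ⟨C, hC, fun σ₁ σ₂ t ht hσ₁ hσ₁₂ => ?_⟩
  have ht0 : t ≠ 0 := fun h => by rw [h, abs_zero] at ht; linarith
  have hlogt : 0 < Real.log |t| := Real.log_pos (by linarith)
  -- the function `u ↦ ζ(u + it)` and its derivative
  set f : ℝ → ℂ := fun u => riemannZeta (u + t * I) with hf
  set f' : ℝ → ℂ := fun u => deriv riemannZeta (u + t * I) with hf'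
  have hderiv : ∀ u : ℝ, HasDerivAt f (f' u) u := by
    intro u
    have h := ZetaOneLine.hasDerivAt_riemannZeta_horizontal ht0 u
    have e : (fun u : ℝ => riemannZeta (u + I * t)) = f := by
      funext u; simp only [hf, mul_comm I]
    have e' : (u : ℂ) + I * t = u + t * I := by ring
    rw [e, e'] at h
    exact h
  have hcont : ContinuousOn f (Icc σ₁ σ₂) := fun u _ => (hderiv u).continuousAt.continuousWithinAt
  have hbound : ∀ u ∈ Ico σ₁ σ₂, ‖f' u‖ ≤ C * Real.log |t| * ‖f u‖ + 0 := by
    intro u hu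
    have hreg : 1 - c / Real.log |t| ≤ u := by
      have : 0 ≤ c / Real.log |t| := by positivity
      linarith [hu.1]
    obtain ⟨hne, hb⟩ := hld u t ht hreg
    rw [add_zero, hf', hf]
    have := mul_le_mul_of_nonneg_right hb (norm_nonneg (riemannZeta (u + t * I)))
    rwa [norm_div, div_mul_cancel₀ _ (norm_ne_zero_iff.2 hne)] at this
  have hG := norm_le_gronwallBound_of_norm_deriv_right_le (δ := ‖f σ₁‖) hcont
    (fun u _ => (hderiv u).hasDerivWithinAt) le_rfl hbound σ₂ ⟨hσ₁₂, le_rfl⟩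
  rw [gronwallBound_ε0] at hG
  simpa only [hf] using hG

/-! ### Ford's bound on the one-line -/

/-- From `zeta_bound_ford` at `σ = 1`: `|ζ(1 + it)| ≤ 76.2 (log|t|)^{2/3}` for `|t| ≥ 3` (negative `t`
by conjugation symmetry). [cite: Ford2002, Theorem 1] -/
theorem norm_zeta_one_line_le (hF : zeta_bound_ford) {t : ℝ} (ht : 3 ≤ |t|) :
    ‖riemannZeta (1 + t * I)‖ ≤ 76.2 * Real.log |t| ^ (2 / 3 : ℝ) := by
  -- positive heights
  have key : ∀ τ : ℝ, 3 ≤ τ → ‖riemannZeta (1 + τ * I)‖ ≤ 76.2 * Real.log τ ^ (2 / 3 : ℝ) := by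
    intro τ hτ
    have h := hF 1 τ hτ (by norm_num) le_rfl
    have e : (4.45 : ℝ) * (1 - 1) ^ (3 / 2 : ℝ) = 0 := by
      rw [sub_self, Real.zero_rpow (by norm_num)]; ring
    rw [e, Real.rpow_zero, mul_one] at h
    exact_mod_cast h
  rcases le_or_gt 0 t with ht0 | ht0
  · rw [abs_of_nonneg ht0] at ht ⊢; exact key t ht
  · rw [abs_of_neg ht0] at ht ⊢
    have e : (1 : ℂ) + (t : ℂ) * I = starRingEnd ℂ (1 + ((-t : ℝ) : ℂ) * I) := by
      apply Complex.ext <;> simp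
    rw [e, riemannZeta_conj, Complex.norm_conj]
    exact key (-t) ht

/-! ### A compactness bound for small heights -/

/-- `ζ` is bounded on `{σ + it : 1 ≤ σ ≤ 2, 2 ≤ |t| ≤ 3}`. [folklore] -/
theorem exists_bound_zeta_box : ∃ B : ℝ, 1 ≤ B ∧ ∀ σ t : ℝ, 1 ≤ σ → σ ≤ 2 → 2 ≤ |t| → |t| ≤ 3 →
    ‖riemannZeta (σ + t * I)‖ ≤ B := by
  -- the box as a continuous image of a compact set
  set K : Set ℂ := (fun p : ℝ × ℝ => (p.1 : ℂ) + p.2 * I) '' (Icc 1 2 ×ˢ (Icc (-3) (-2) ∪ Icc 2 3)) with hK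
  have hKc : IsCompact K := by
    refine IsCompact.image (isCompact_Icc.prod (isCompact_Icc.union isCompact_Icc)) ?_
    fun_prop
  have hK1 : ∀ s ∈ K, s ≠ 1 := by
    rintro s ⟨p, hp, rfl⟩ h
    have him := congrArg Complex.im h
    simp at him
    rcases hp.2 with h2 | h2 <;> [linarith [h2.2]; linarith [h2.1]]
  have hcont : ContinuousOn riemannZeta K := fun s hs =>
    (differentiableAt_riemannZeta (hK1 s hs)).continuousAt.continuousWithinAt
  obtain ⟨B, hB⟩ := hKc.exists_bound_of_continuousOn hcont
  refine ⟨max B 1, le_max_right _ _, fun σ t hσ1 hσ2 ht2 ht3 => (hB _ ?_).trans (le_max_left _ _)⟩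
  refine ⟨(σ, t), ⟨⟨hσ1, hσ2⟩, ?_⟩, rfl⟩
  rcases le_or_gt 0 t with h0 | h0
  · right; rw [abs_of_nonneg h0] at ht2 ht3; exact ⟨ht2, ht3⟩
  · left; rw [abs_of_neg h0] at ht2 ht3; exact ⟨by linarith, by linarith⟩

/-! ### The distance `𝔻(1, n^{it}; x)²` for `2 ≤ |t| ≤ x^A` -/

/-- The trivial character mod `1` twisted by `n^{it}` is `n ↦ n^{it}`. [folklore] -/
theorem twistedChar_one (u : ℝ) :
    Sieve.twistedChar (1 : DirichletCharacter ℂ 1) u = fun n : ℕ => (n : ℂ) ^ ((u : ℂ) * I) := by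
  funext n
  rw [Sieve.twistedChar, MulChar.one_apply (isUnit_of_subsingleton _), one_mul]

/-- **The Vinogradov–Korobov-type lower bound for the distance from `n^{it}`, from Ford's bound**:
for every `A > 0` there are `x₀, C` such that for `x ≥ x₀` and `2 ≤ |t| ≤ x^A`,
`𝔻(1, n^{it}; x)² ≥ (1/3) log log x − C`.
Proof: `𝔻(1, n^{it}; x)² = log log x − log|ζ(σ_x − it)| + O(1)` (`σ_x = 1 + 1/log x`;
`exists_pretentiousDistSq_one_zeta_approx`), `|ζ(σ_x − it)| ≤ e^{CA} |ζ(1 − it)|`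
(`exists_norm_zeta_right_le`, as `log|t| ≤ A log x`) and `|ζ(1 − it)| ≤ 76.2 (log|t|)^{2/3}` (Ford),
so `log|ζ(σ_x − it)| ≤ (2/3) log log x + O_A(1)`; small `|t| ≤ 3` by compactness.  This is the
analytic content of Matomäki–Radziwiłł 2016, Lemma 2 ("by the zero-free region for the Riemann
zeta-function" = Vinogradov–Korobov).
[cite: MatomakiRadziwillAnnals2016, Lemma 2 (proof)] [cite: Ford2002, Theorem 1] -/
theorem pretentiousDistSq_one_twist_ge (hF : zeta_bound_ford) {A : ℝ} (hA : 0 < A) :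
    ∃ x₀ C : ℝ, 3 ≤ x₀ ∧ ∀ x : ℝ, x₀ ≤ x → ∀ t : ℝ, 2 ≤ |t| → |t| ≤ x ^ A →
      Real.log (Real.log x) / 3 - C ≤
        Sieve.pretentiousDistSq 1 (fun n : ℕ => (n : ℂ) ^ ((t : ℂ) * I)) x := by
  obtain ⟨x₁, C₁, hx₁, hD⟩ := exists_pretentiousDistSq_one_zeta_approx
  obtain ⟨C₂, hC₂, hG⟩ := exists_norm_zeta_right_le
  obtain ⟨B, hB1, hB⟩ := exists_bound_zeta_box
  -- constants
  set x₀ : ℝ := max x₁ (Real.exp 1) with hx₀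
  set C : ℝ := C₁ + max (Real.log B) (Real.log 76.2 + (2 / 3) * |Real.log A| + C₂ * A) with hCdef
  refine ⟨x₀, C, le_trans hx₁ (le_max_left _ _), fun x hx t ht2 htA => ?_⟩
  have hx1 : x₁ ≤ x := le_trans (le_max_left _ _) hx
  have hxe : Real.exp 1 ≤ x := le_trans (le_max_right _ _) hx
  have hx3 : 3 ≤ x := le_trans hx₁ hx1
  have hlogx : 1 ≤ Real.log x := by
    rw [← Real.log_exp 1]; exact Real.log_le_log (Real.exp_pos 1) hxe
  have hlogx0 : 0 < Real.log x := by linarith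
  have hσ1 : 1 < sigmaX x := one_lt_sigmaX (by linarith)
  have hσ2 : sigmaX x ≤ 2 := sigmaX_le_two hxe
  have hσsub : sigmaX x - 1 = 1 / Real.log x := by rw [sigmaX]; ring
  -- (D1c) at `u = t`
  have hD' := hD x hx1 t
  rw [twistedChar_one] at hD'
  have hDge : Real.log (Real.log x) - Real.log ‖riemannZeta ((sigmaX x : ℂ) - t * I)‖ - C₁ ≤
      Sieve.pretentiousDistSq 1 (fun n : ℕ => (n : ℂ) ^ ((t : ℂ) * I)) x := by
    have := (abs_le.1 hD').1; linarith
  -- the value `ζ(σ_x − it) = ζ(σ_x + (−t) i)`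
  have hs : (sigmaX x : ℂ) - t * I = (sigmaX x : ℂ) + ((-t : ℝ) : ℂ) * I := by push_cast; ring
  have hne : riemannZeta ((sigmaX x : ℂ) - t * I) ≠ 0 := by
    refine riemannZeta_ne_zero_of_one_lt_re ?_
    simp; exact hσ1
  have hnorm0 : 0 < ‖riemannZeta ((sigmaX x : ℂ) - t * I)‖ := norm_pos_iff.2 hne
  have habs : |(-t)| = |t| := abs_neg t
  -- bound `log |ζ(σ_x − it)|`
  have hlogζ : Real.log ‖riemannZeta ((sigmaX x : ℂ) - t * I)‖ ≤
      (2 / 3) * Real.log (Real.log x) +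
        max (Real.log B) (Real.log 76.2 + (2 / 3) * |Real.log A| + C₂ * A) := by
    have hllx : 0 ≤ Real.log (Real.log x) := Real.log_nonneg hlogx
    rcases le_or_gt |t| 3 with ht3 | ht3
    · -- small heights: compactness
      have hb := hB (sigmaX x) (-t) hσ1.le hσ2 (by rw [habs]; exact ht2) (by rw [habs]; exact ht3)
      rw [← hs] at hb
      calc Real.log ‖riemannZeta ((sigmaX x : ℂ) - t * I)‖ ≤ Real.log B :=
            Real.log_le_log hnorm0 hb
        _ ≤ (2 / 3) * Real.log (Real.log x) + max (Real.log B) _ := by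
            have := le_max_left (Real.log B) (Real.log 76.2 + (2 / 3) * |Real.log A| + C₂ * A)
            nlinarith
    · -- large heights: Grönwall + Ford
      have ht2' : 2 ≤ |(-t)| := by rw [habs]; exact ht2
      have hg := hG 1 (sigmaX x) (-t) ht2' le_rfl hσ1.le
      rw [← hs] at hg
      have hford := norm_zeta_one_line_le hF (t := -t) (by rw [habs]; exact ht3.le)
      rw [habs] at hford hg
      push_cast at hg hford
      have hlogt : 0 < Real.log |t| := Real.log_pos (by linarith)
      have hlogtA : Real.log |t| ≤ A * Real.log x := by
        calc Real.log |t| ≤ Real.log (x ^ A) := Real.log_le_log (by linarith) htA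
          _ = A * Real.log x := Real.log_rpow (by linarith) A
      -- the exponential factor
      have hexp : Real.exp (C₂ * Real.log |t| * (sigmaX x - 1)) ≤ Real.exp (C₂ * A) := by
        refine Real.exp_le_exp.2 ?_
        rw [hσsub]
        calc C₂ * Real.log |t| * (1 / Real.log x) = C₂ * (Real.log |t| / Real.log x) := by ring
          _ ≤ C₂ * A := by
              refine mul_le_mul_of_nonneg_left ?_ hC₂
              rw [div_le_iff₀ hlogx0]; exact hlogtA
      -- combine
      have hmain : ‖riemannZeta ((sigmaX x : ℂ) - t * I)‖ ≤
          76.2 * Real.log |t| ^ (2 / 3 : ℝ) * Real.exp (C₂ * A) :=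
        hg.trans (mul_le_mul hford hexp (Real.exp_pos _).le (by positivity))
      have hpos : 0 < 76.2 * Real.log |t| ^ (2 / 3 : ℝ) * Real.exp (C₂ * A) := by positivity
      have hlog_main : Real.log (76.2 * Real.log |t| ^ (2 / 3 : ℝ) * Real.exp (C₂ * A)) =
          Real.log 76.2 + (2 / 3) * Real.log (Real.log |t|) + C₂ * A := by
        rw [Real.log_mul (by positivity) (Real.exp_pos _).ne', Real.log_mul (by norm_num) (by positivity),
          Real.log_rpow hlogt, Real.log_exp]
      have hllt : Real.log (Real.log |t|) ≤ Real.log (Real.log x) + |Real.log A| := by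
        calc Real.log (Real.log |t|) ≤ Real.log (A * Real.log x) := Real.log_le_log hlogt hlogtA
          _ = Real.log A + Real.log (Real.log x) := Real.log_mul hA.ne' hlogx0.ne'
          _ ≤ Real.log (Real.log x) + |Real.log A| := by have := le_abs_self (Real.log A); linarith
      calc Real.log ‖riemannZeta ((sigmaX x : ℂ) - t * I)‖
          ≤ Real.log (76.2 * Real.log |t| ^ (2 / 3 : ℝ) * Real.exp (C₂ * A)) := Real.log_le_log hnorm0 hmain
        _ = Real.log 76.2 + (2 / 3) * Real.log (Real.log |t|) + C₂ * A := hlog_main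
        _ ≤ (2 / 3) * Real.log (Real.log x) + (Real.log 76.2 + (2 / 3) * |Real.log A| + C₂ * A) := by
            nlinarith
        _ ≤ (2 / 3) * Real.log (Real.log x) + max (Real.log B) _ := by
            have := le_max_right (Real.log B) (Real.log 76.2 + (2 / 3) * |Real.log A| + C₂ * A)
            linarith
  rw [hCdef]
  linarith

/-! ### Matomäki–Radziwiłł 2016, Lemma 2 -/

/-- The pointwise inequality behind `𝔻(1, p^{2iα}) ≤ 2 𝔻(f, p^{iα})` for real `f ∈ [-1, 1]`:
with `w = p^{iα}` (`|w| = 1`), `1 − Re(w̄²) ≤ 4 (1 − f Re w̄)` (both sides in terms of `c = Re w̄`: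
`2 − 2c² ≤ 4 − 4fc` as `2(1 − |c|)² ≥ 0`). [folklore] -/
theorem one_sub_re_sq_le {w : ℂ} (hw : ‖w‖ = 1) {f : ℝ} (hf : |f| ≤ 1) :
    1 - (starRingEnd ℂ (w ^ 2)).re ≤ 4 * (1 - ((f : ℂ) * starRingEnd ℂ w).re) := by
  have hc2 : w.re ^ 2 + w.im ^ 2 = 1 := by
    have := Complex.sq_norm w
    rw [hw, Complex.normSq_apply] at this
    nlinarith
  have hre2 : (starRingEnd ℂ (w ^ 2)).re = 2 * w.re ^ 2 - 1 := by
    rw [Complex.conj_re, sq, Complex.mul_re]; nlinarith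
  have hre1 : ((f : ℂ) * starRingEnd ℂ w).re = f * w.re := by
    simp [Complex.mul_re]
  rw [hre2, hre1]
  have hc : |w.re| ≤ 1 := by
    rw [abs_le]; constructor <;> nlinarith [sq_nonneg w.im]
  have hfc : f * w.re ≤ |w.re| := by
    calc f * w.re ≤ |f * w.re| := le_abs_self _
      _ = |f| * |w.re| := abs_mul _ _
      _ ≤ 1 * |w.re| := mul_le_mul_of_nonneg_right hf (abs_nonneg _)
      _ = |w.re| := one_mul _
  have hsq : w.re ^ 2 = |w.re| ^ 2 := (sq_abs _).symm
  nlinarith [sq_nonneg (1 - |w.re|)]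

/-- `𝔻(1, n^{2iα}; x)² ≤ 4 𝔻(f, n^{iα}; x)²` for real `f` with `|f| ≤ 1` (the paper's
"`2𝔻(f, p^{iα}) ≥ 𝔻(1, p^{2iα})` by the triangle inequality", here termwise). [folklore] -/
theorem pretentiousDistSq_one_double_le {f : ℕ → ℝ} (hf : ∀ n, |f n| ≤ 1) (α x : ℝ) :
    Sieve.pretentiousDistSq 1 (fun n : ℕ => (n : ℂ) ^ (((2 * α : ℝ) : ℂ) * I)) x ≤
      4 * Sieve.pretentiousDistSq (fun n => (f n : ℂ)) (fun n : ℕ => (n : ℂ) ^ ((α : ℂ) * I)) x := by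
  rw [Sieve.pretentiousDistSq, Sieve.pretentiousDistSq, Finset.mul_sum]
  refine Finset.sum_le_sum fun p hp => ?_
  have hp0 : 0 < p := (Nat.prime_of_mem_primesBelow
    (by simpa [Nat.primesLE] using hp) |>.pos)
  have hp0' : (p : ℂ) ≠ 0 := by exact_mod_cast hp0.ne'
  set w : ℂ := (p : ℂ) ^ ((α : ℂ) * I) with hwdef
  have hw : ‖w‖ = 1 := by
    rw [hwdef, Complex.norm_natCast_cpow_of_pos hp0]; simp
  have hsq : (p : ℂ) ^ (((2 * α : ℝ) : ℂ) * I) = w ^ 2 := by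
    rw [hwdef, sq, ← Complex.cpow_add _ _ hp0']; push_cast; ring_nf
  rw [hsq, Pi.one_apply, one_mul, mul_div_assoc']
  rw [div_le_div_iff_of_pos_right (by exact_mod_cast hp0)]
  exact one_sub_re_sq_le hw (hf p)

/-- **Matomäki–Radziwiłł 2016, Lemma 2, from Ford's bound** (squared form, the `ε` of the printed
statement taken `0`): for every `A > 0` there are `x₀, C` such that for every `f : ℕ → [-1, 1]`
(multiplicativity is not needed), `x ≥ x₀` and `1 ≤ |α| ≤ x^A`,
`𝔻(f, n^{iα}; x)² ≥ (1/12) log log x − C`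
(printed: `𝔻(f, p^{iα}; x) ≥ (1/(2√3) − ε) √(log log x) + O(1)`).
Proof: `4 𝔻(f, p^{iα})² ≥ 𝔻(1, p^{2iα})² ≥ (1/3) log log x − O_A(1)` (`pretentiousDistSq_one_twist_ge`
with `A + 1`, as `2 ≤ |2α| ≤ 2x^A ≤ x^{A+1}`).
[cite: MatomakiRadziwillAnnals2016, Lemma 2] [cite: Ford2002, Theorem 1] -/
theorem matomakiRadziwill_lemma2_of_ford (hF : zeta_bound_ford) {A : ℝ} (hA : 0 < A) :
    ∃ x₀ C : ℝ, 3 ≤ x₀ ∧ ∀ x : ℝ, x₀ ≤ x → ∀ α : ℝ, 1 ≤ |α| → |α| ≤ x ^ A →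
      ∀ f : ℕ → ℝ, (∀ n, |f n| ≤ 1) →
        Real.log (Real.log x) / 12 - C ≤
          Sieve.pretentiousDistSq (fun n => (f n : ℂ)) (fun n : ℕ => (n : ℂ) ^ ((α : ℂ) * I)) x := by
  obtain ⟨x₀, C, hx₀, h⟩ := pretentiousDistSq_one_twist_ge hF (A := A + 1) (by linarith)
  refine ⟨x₀, C / 4, hx₀, fun x hx α hα1 hαA f hf => ?_⟩
  have hx3 : 3 ≤ x := hx₀.trans hx
  have h2α : 2 ≤ |2 * α| := by rw [abs_mul, abs_two]; linarith
  have h2αA : |2 * α| ≤ x ^ (A + 1) := by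
    rw [abs_mul, abs_two, Real.rpow_add (by linarith), Real.rpow_one]
    have : 0 ≤ x ^ A := by positivity
    nlinarith
  have h1 := h x hx (2 * α) h2α h2αA
  have h2 := pretentiousDistSq_one_double_le hf α x
  linarith

end PretentiousFord

end Literature.NumberTheory.LFunctions
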